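import Mathlib
import HarnessLib
import Literature.Analysis.FluidPDE.ClassicalSolution
import Literature.Analysis.FluidPDE.LerayHopf
import Literature.Analysis.FluidPDE.TaoFiniteEnergyLerayHopf
import Literature.Analysis.FluidPDE.NormalisedPressureDischarge
import Summits.NavierStokesRegularity.NavierStokesRegularity.Theses.QuarterJolt
import Summits.NavierStokesRegularity.NavierStokesRegularity.Theorems.QuarterJoltEnergyJumpLaw
import Summits.NavierStokesRegularity.NavierStokesRegularity.Theorems.CertifiedBlowupCertifiedBlowupAxisymBlowupEnergyDrain

/-!
# Route QuarterJolt — crux `NoTerminalJolt` (stmt-NavierStokesRegularity-26463), LEAD line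
# `regular_split` rev 4: the energy jump IS Leray's energy defect at `T`

Seat ns-ntj-p1 g3 (LEAD of the crux; `--supports 26463 --as helper`), sequel of
`QuarterJoltEnergyJumpLaw.lean`. There, for a classical solution of unforced Navier–Stokes on
`ℝ³ × [0,T)` (`ν > 0`) which is Leray–Hopf on `[0,T]` from `u 0`, the squared `L²` distance to the
terminal value was shown to converge, `∫‖u(t) − u(T)‖² → J ≥ 0` (`exists_energyJump`). Here `J` is
IDENTIFIED with the defect in Leray's energy inequality at the terminal time:

* `energyEq_before` — the ENERGY EQUALITY BEFORE `T` (decay-free): for `0 ≤ s ≤ t < T`,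
  `E(u t) + ν∫ₛᵗ∫|∇u|² = E(u s)` (`E = ½∫|·|²`, `VectorCalculus.kineticEnergy`). On the closed slab
  `[0, (t+T)/2]` the solution is classical with energy `≤ 2E(u 0)` (Leray–Hopf), hence in Tao's finite
  energy class, where the energy equality is the tree theorem
  `IsClassicalNSSolutionOn.energyEq_of_finiteEnergy` (Tao 2013 Lemma 8.1, all inputs discharged:
  `tao_pressure_normalisation_holds`, `tao2011_pressureTerm_estimate_holds`).
* `tendsto_setLIntegral_Ioo_nhdsLT` — continuity from below: `∫₀ᵗ F → ∫₀ᵀ F` as `t ↑ T` for every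
  `F : ℝ → ℝ≥0∞` (measure `volume.withDensity F` along `Ioo 0 t ↑ Ioo 0 T`).
* `tendsto_integral_norm_sub_sq_energyDefect` — **THE ENERGY JUMP IS THE ENERGY DEFECT**:
  `∫‖u(t) − u(T)‖² → 2·(E(u 0) − ν∫₀ᵀ∫|∇u|² − E(u T))` as `t ↑ T`; the limit is `≥ 0` by Leray's
  energy inequality at `T` (`EnergyDrain.dissipation_le_energy_sub`, the final time included).
* `tendsto_eLpNorm_sub_iff_energyEquality` — hence, in the frame, STRONG `L²`-CONTINUITY INTO `T`
  (the conclusion of stub `stub_typeIIEnergyEquality` of `Lines/regular_split.lean` rev 4) is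
  EQUIVALENT to LERAY'S ENERGY EQUALITY ON `[0,T]`, `E(u T) + ν∫₀ᵀ∫|∇u|² = E(u 0)` — the energy
  equality AT the (possibly singular) time `T` in the sense of Leslie–Shvydkoy (ARMA 230 (2018),
  Thm. 1.2: known at Type-I-in-time first blow-ups; open otherwise);
* `energyEquality_of_tendsto_joltFunctional` / `lerayEnergyEquality_of_noTerminalJolt` — no terminal
  jolt at `T` ⇒ Leray's energy equality on `[0,T]`; the crux BY NAME ⇒ Leray's energy equality on
  `[0,T]` for EVERY `T > 0` of every frame solution.

HONEST FRAMING: a priori identities of the Leray–Hopf class and implications between OPEN statements;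
nothing here proves `NoTerminalJolt`, the energy equality at a first blow-up time, or Navier–Stokes
regularity. No summit statement is proved here. [folklore]

## References
* T. Tao, *Localisation and compactness properties of the Navier–Stokes global regularity problem*,
  Anal. PDE 6 (2013), Lemma 8.1. [Tao2011]
* T. M. Leslie, R. Shvydkoy, ARMA 230 (2018), Thm. 1.2 (arXiv:1705.04420). [LeslieShvydkoy2017]
* J. Leray, Acta Math. 63 (1934), §31 (5.1)–(5.2). [Leray1934]
-/

noncomputable section

-- the summit and its single sub-problem share the name (CONVENTIONS §1), as in every Theorems file
set_option linter.dupNamespace false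

namespace Summit.NavierStokesRegularity.NavierStokesRegularity.Theorems

open MeasureTheory Set Function Filter Topology
open scoped NNReal ENNReal InnerProductSpace RealInnerProductSpace
open Literature.Analysis.FluidPDE

namespace NoTerminalJolt

/-! ### Continuity from below of the dissipation integral -/

/-- **Continuity from below**: for every `F : ℝ → ℝ≥0∞` and `T > 0`, `∫⁻_{(0,t)} F → ∫⁻_{(0,T)} F` as
`t ↑ T` (the measure `volume.withDensity F` is continuous along `Ioo 0 (T − T/(n+2)) ↑ Ioo 0 T`, and
`t ↦ ∫⁻_{(0,t)} F` is monotone). [folklore] -/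
theorem tendsto_setLIntegral_Ioo_nhdsLT (F : ℝ → ℝ≥0∞) {T : ℝ} (hT : 0 < T) :
    Tendsto (fun t => ∫⁻ τ in Ioo 0 t, F τ) (𝓝[<] T) (𝓝 (∫⁻ τ in Ioo 0 T, F τ)) := by
  set μF : Measure ℝ := volume.withDensity F with hμF
  have hg : ∀ t, ∫⁻ τ in Ioo 0 t, F τ = μF (Ioo 0 t) := fun t =>
    (withDensity_apply F measurableSet_Ioo).symm
  simp_rw [hg]
  set s : ℕ → Set ℝ := fun n => Ioo 0 (T - T / (n + 2)) with hs
  have hmono : Monotone s := by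
    intro m n hmn
    refine Ioo_subset_Ioo le_rfl (sub_le_sub_left ?_ _)
    exact div_le_div_of_nonneg_left hT.le (by positivity)
      (by exact_mod_cast Nat.add_le_add_right hmn 2)
  have hU : (⋃ n, s n) = Ioo 0 T := by
    apply Subset.antisymm
    · exact iUnion_subset fun n => Ioo_subset_Ioo_right (sub_le_self _ (by positivity))
    · intro τ hτ
      obtain ⟨n, hn⟩ := exists_nat_gt (T / (T - τ))
      refine mem_iUnion.2 ⟨n, hτ.1, ?_⟩
      have hTτ : 0 < T - τ := sub_pos.2 hτ.2
      have h1 : T / (n + 2 : ℝ) < T - τ := by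
        rw [div_lt_iff₀ (by positivity)]
        have := (div_lt_iff₀ hTτ).1 hn
        nlinarith
      linarith
  have hseq : Tendsto (fun n => μF (s n)) atTop (𝓝 (μF (Ioo 0 T))) := by
    rw [← hU]; exact tendsto_measure_iUnion_atTop hmono
  refine tendsto_order.2 ⟨fun a ha => ?_, fun b hb => ?_⟩
  · obtain ⟨n, hn⟩ := (hseq.eventually (lt_mem_nhds ha)).exists
    have htn : T - T / (n + 2) < T := sub_lt_self _ (by positivity)
    filter_upwards [Ioo_mem_nhdsLT htn] with t ht
    exact hn.trans_le (measure_mono (Ioo_subset_Ioo_right ht.1.le))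
  · filter_upwards [self_mem_nhdsWithin] with t ht
    exact (measure_mono (Ioo_subset_Ioo_right (le_of_lt ht))).trans_lt hb

/-! ### The energy equality before the terminal time (decay-free) -/

/-- **Energy equality before `T`.** Let `(u,p)` be a classical solution of unforced Navier–Stokes on
`ℝ³ × [0,T)`, `ν > 0`, Leray–Hopf on `[0,T]` from `u 0` (no decay hypothesis). Then for
`0 ≤ s ≤ t < T`: `E(u t) + ν∫ₛᵗ∫|∇u|²_F = E(u s)`. Proof: on the closed slab `[0,T']`,
`T' = (t+T)/2 < T`, the solution is classical with `∫|u(τ)|² ≤ 2E(u 0)` (energy inequality), so Tao's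
finite energy theory applies (`energyClass_of_finiteEnergy`, `lintegral_enorm_pow_three_lt_top`,
`energyEq_of_finiteEnergy` with `tao_pressure_normalisation_holds`,
`tao2011_pressureTerm_estimate_holds`). [cite: Tao2011, Lemma 8.1] -/
theorem energyEq_before {ν T : ℝ} (hν : 0 < ν)
    {u : ℝ → EuclideanSpace ℝ (Fin 3) → EuclideanSpace ℝ (Fin 3)}
    {p : ℝ → EuclideanSpace ℝ (Fin 3) → ℝ}
    (hcl : IsClassicalNSSolutionOn (Ico 0 T) ν 0 u p) (hLH : IsLerayHopfOn T ν 0 (u 0) u)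
    {s t : ℝ} (hs : 0 ≤ s) (hst : s ≤ t) (htT : t < T) :
    VectorCalculus.kineticEnergy (u t) +
      ν * (∫⁻ τ in Ioo s t, ∫⁻ x, ENNReal.ofReal (frobeniusNormSq (fderiv ℝ (u τ) x))).toReal =
      VectorCalculus.kineticEnergy (u s) := by
  set T' : ℝ := (t + T) / 2 with hT'
  have htT' : t < T' := by rw [hT']; linarith
  have hT'T : T' < T := by rw [hT']; linarith
  have hT'0 : 0 < T' := lt_of_le_of_lt (hs.trans hst) htT'
  have hcl' : IsClassicalNSSolutionOn (Icc 0 T') ν 0 u p :=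
    hcl.mono (Icc_subset_Ico_right hT'T) (uniqueDiffOn_Icc hT'0)
  set A : ℝ≥0∞ := ENNReal.ofReal (2 * VectorCalculus.kineticEnergy (u 0)) with hA
  have hAt : A ≠ ⊤ := ENNReal.ofReal_ne_top
  have hAle : ∀ τ ∈ Icc 0 T', ∫⁻ x, ‖u τ x‖ₑ ^ 2 ≤ A := fun τ hτ =>
    hLH.lintegral_enorm_sq_le hν.le ⟨hτ.1, hτ.2.trans hT'T.le⟩
  obtain ⟨-, -, -, -, hgrad⟩ := energyClass_of_finiteEnergy hcl' hν hT'0 ⟨A, hAt.lt_top, hAle⟩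
  have hu₃ := hcl'.lintegral_enorm_pow_three_lt_top hAt hAle hgrad
  exact hcl'.energyEq_of_finiteEnergy tao_pressure_normalisation_holds
    tao2011_pressureTerm_estimate_holds hν hT'0 hAt hAle hgrad hu₃ hs hst htT'.le

/-! ### The energy jump is Leray's energy defect at `T` -/

/-- **THE ENERGY JUMP IS THE ENERGY DEFECT.** In the setting of `energyEq_before` (classical on
`[0,T)`, `ν > 0`, Leray–Hopf on `[0,T]` from `u 0`, `T > 0`): the total dissipation
`∫₀ᵀ∫|∇u|²_F` is finite and
`∫‖u(t) − u(T)‖² → 2·(E(u 0) − ν∫₀ᵀ∫|∇u|²_F − E(u T))` as `t ↑ T` — the squared `L²` distance to the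
terminal value converges to (twice) the DEFECT in Leray's energy inequality at `T`
(`E(u T) + ν∫₀ᵀ∫|∇u|² ≤ E(u 0)`, `EnergyDrain.dissipation_le_energy_sub`). Ingredients: the energy-jump
law `exists_energyJump`, the energy equality before `T`, continuity from below of the dissipation.
[folklore] -/
theorem tendsto_integral_norm_sub_sq_energyDefect {ν T : ℝ} (hν : 0 < ν) (hT : 0 < T)
    {u : ℝ → EuclideanSpace ℝ (Fin 3) → EuclideanSpace ℝ (Fin 3)}
    {p : ℝ → EuclideanSpace ℝ (Fin 3) → ℝ}
    (hcl : IsClassicalNSSolutionOn (Ico 0 T) ν 0 u p) (hLH : IsLerayHopfOn T ν 0 (u 0) u) :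
    (∫⁻ τ in Ioo 0 T, ∫⁻ x, ENNReal.ofReal (frobeniusNormSq (fderiv ℝ (u τ) x))) ≠ ⊤ ∧
    Tendsto (fun t => ∫ x, ‖u t x - u T x‖ ^ 2) (𝓝[<] T)
      (𝓝 (2 * (VectorCalculus.kineticEnergy (u 0) -
        ν * (∫⁻ τ in Ioo 0 T, ∫⁻ x, ENNReal.ofReal (frobeniusNormSq (fderiv ℝ (u τ) x))).toReal -
        VectorCalculus.kineticEnergy (u T)))) := by
  set D : ℝ → ℝ≥0∞ := fun t => ∫⁻ τ in Ioo 0 t, ∫⁻ x, ENNReal.ofReal (frobeniusNormSq (fderiv ℝ (u τ) x))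
    with hD
  have hfin : D T ≠ ⊤ :=
    (CertifiedBlowupAxisymBlowup.EnergyDrain.dissipation_le_energy_sub hν hcl hLH le_rfl hT.le le_rfl).1
  refine ⟨hfin, ?_⟩
  obtain ⟨J, -, -, hlimE, hlimD⟩ := exists_energyJump hν hT hcl hLH
  -- the dissipation is continuous from below at `T`, in `ℝ`
  have hDlim : Tendsto (fun t => (D t).toReal) (𝓝[<] T) (𝓝 (D T).toReal) :=
    (ENNReal.tendsto_toReal hfin).comp (tendsto_setLIntegral_Ioo_nhdsLT _ hT)
  -- on `(0,T)` the energy drop is `2(E(u 0) − ν D t) − 2 E(u T)`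
  have hev : (fun t => (∫ x, ‖u t x‖ ^ 2) - ∫ x, ‖u T x‖ ^ 2) =ᶠ[𝓝[<] T]
      fun t => 2 * (VectorCalculus.kineticEnergy (u 0) - ν * (D t).toReal) -
        2 * VectorCalculus.kineticEnergy (u T) := by
    filter_upwards [Ioo_mem_nhdsLT hT] with t ht
    have hE := energyEq_before hν hcl hLH le_rfl ht.1.le ht.2
    have h2t : ∫ x, ‖u t x‖ ^ 2 = 2 * VectorCalculus.kineticEnergy (u t) := by
      simp only [VectorCalculus.kineticEnergy]; ring
    have h2T : ∫ x, ‖u T x‖ ^ 2 = 2 * VectorCalculus.kineticEnergy (u T) := by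
      simp only [VectorCalculus.kineticEnergy]; ring
    rw [h2t, h2T]
    simp only [hD] at hE ⊢
    linarith
  have hlim2 : Tendsto (fun t => (∫ x, ‖u t x‖ ^ 2) - ∫ x, ‖u T x‖ ^ 2) (𝓝[<] T)
      (𝓝 (2 * (VectorCalculus.kineticEnergy (u 0) - ν * (D T).toReal) -
        2 * VectorCalculus.kineticEnergy (u T))) := by
    refine Tendsto.congr' hev.symm ?_
    exact ((tendsto_const_nhds.sub (hDlim.const_mul ν)).const_mul 2).sub tendsto_const_nhds
  have hJ : J = 2 * (VectorCalculus.kineticEnergy (u 0) - ν * (D T).toReal) -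
      2 * VectorCalculus.kineticEnergy (u T) := tendsto_nhds_unique hlimE hlim2
  have hgoal : 2 * (VectorCalculus.kineticEnergy (u 0) - ν * (D T).toReal -
      VectorCalculus.kineticEnergy (u T)) = J := by rw [hJ]; ring
  rw [hgoal]
  exact hlimD

/-- **Leray's energy inequality at the terminal time** (restated from
`EnergyDrain.dissipation_le_energy_sub`, the final time included): `E(u T) + ν∫₀ᵀ∫|∇u|²_F ≤ E(u 0)`.
[cite: Leray1934, §31 (5.2)] -/
theorem lerayEnergyIneq_terminal {ν T : ℝ} (hν : 0 < ν) (hT : 0 < T)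
    {u : ℝ → EuclideanSpace ℝ (Fin 3) → EuclideanSpace ℝ (Fin 3)}
    {p : ℝ → EuclideanSpace ℝ (Fin 3) → ℝ}
    (hcl : IsClassicalNSSolutionOn (Ico 0 T) ν 0 u p) (hLH : IsLerayHopfOn T ν 0 (u 0) u) :
    VectorCalculus.kineticEnergy (u T) +
      ν * (∫⁻ τ in Ioo 0 T, ∫⁻ x, ENNReal.ofReal (frobeniusNormSq (fderiv ℝ (u τ) x))).toReal ≤
      VectorCalculus.kineticEnergy (u 0) := by
  have h := (CertifiedBlowupAxisymBlowup.EnergyDrain.dissipation_le_energy_sub hν hcl hLH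
    le_rfl hT.le le_rfl).2
  linarith

/-- **No energy jump ⟺ Leray's energy equality on `[0,T]`.** In the frame (classical on `[0,T)`,
`ν > 0`, Leray–Hopf on `[0,T]` from `u 0`, `T > 0`; no decay needed), the trajectory is strongly
`L²`-continuous into `T` — the conclusion of stub `stub_typeIIEnergyEquality` of
`Cruxes/NoTerminalJolt/Lines/regular_split.lean` rev 4 — IFF the energy equality holds on the closed
interval `[0,T]`, `E(u T) + ν∫₀ᵀ∫|∇u|²_F = E(u 0)`: the energy equality AT the (possibly singular)
time `T`. [folklore] -/
theorem tendsto_eLpNorm_sub_iff_energyEquality {ν T : ℝ} (hν : 0 < ν) (hT : 0 < T)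
    {u : ℝ → EuclideanSpace ℝ (Fin 3) → EuclideanSpace ℝ (Fin 3)}
    {p : ℝ → EuclideanSpace ℝ (Fin 3) → ℝ}
    (hcl : IsClassicalNSSolutionOn (Ico 0 T) ν 0 u p) (hLH : IsLerayHopfOn T ν 0 (u 0) u) :
    Tendsto (fun t => eLpNorm (u t - u T) 2 volume) (𝓝[<] T) (𝓝 0) ↔
      VectorCalculus.kineticEnergy (u T) +
        ν * (∫⁻ τ in Ioo 0 T, ∫⁻ x, ENNReal.ofReal (frobeniusNormSq (fderiv ℝ (u τ) x))).toReal =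
        VectorCalculus.kineticEnergy (u 0) := by
  obtain ⟨-, hlim⟩ := tendsto_integral_norm_sub_sq_energyDefect hν hT hcl hLH
  rw [tendsto_eLpNorm_sub_iff_tendsto_integral_norm_sub_sq hT hLH]
  constructor
  · intro h
    have h0 := tendsto_nhds_unique hlim h
    linarith
  · intro h
    have h0 : 2 * (VectorCalculus.kineticEnergy (u 0) -
        ν * (∫⁻ τ in Ioo 0 T, ∫⁻ x, ENNReal.ofReal (frobeniusNormSq (fderiv ℝ (u τ) x))).toReal -
        VectorCalculus.kineticEnergy (u T)) = 0 := by linarith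
    rw [h0] at hlim
    exact hlim

/-- **No terminal jolt ⇒ Leray's energy equality on `[0,T]`** (frame: classical on `[0,T)`, `ν > 0`,
Leray–Hopf on `[0,T]` from `u 0`, `T > 0`): if `(√(T−t))⁻¹ ∫‖u(t) − u(T)‖² → 0` then
`E(u T) + ν∫₀ᵀ∫|∇u|²_F = E(u 0)`. [folklore] -/
theorem energyEquality_of_tendsto_joltFunctional {ν T : ℝ} (hν : 0 < ν) (hT : 0 < T)
    {u : ℝ → EuclideanSpace ℝ (Fin 3) → EuclideanSpace ℝ (Fin 3)}
    {p : ℝ → EuclideanSpace ℝ (Fin 3) → ℝ}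
    (hcl : IsClassicalNSSolutionOn (Ico 0 T) ν 0 u p) (hLH : IsLerayHopfOn T ν 0 (u 0) u)
    (hJ : Tendsto (fun t : ℝ => (Real.sqrt (T - t))⁻¹ * ∫ x, ‖u t x - u T x‖ ^ 2)
      (𝓝[<] T) (𝓝 0)) :
    VectorCalculus.kineticEnergy (u T) +
      ν * (∫⁻ τ in Ioo 0 T, ∫⁻ x, ENNReal.ofReal (frobeniusNormSq (fderiv ℝ (u τ) x))).toReal =
      VectorCalculus.kineticEnergy (u 0) :=
  (tendsto_eLpNorm_sub_iff_energyEquality hν hT hcl hLH).1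
    (tendsto_eLpNorm_sub_of_tendsto_joltFunctional hT hLH hJ)

/-- **`NoTerminalJolt ⇒ Leray's energy equality on every closed interval`** (the crux BY NAME ⇒ for
every `ν, T > 0` and every frame solution, `E(u T) + ν∫₀ᵀ∫|∇u|²_F = E(u 0)` — the energy equality
INCLUDING the terminal time, in particular at every hypothetical first blow-up time; open in print
beyond Type-I-in-time blow-ups, Leslie–Shvydkoy 2018 Thm. 1.2). Conditional on the OPEN crux; nothing
is asserted about it. [folklore] -/
theorem lerayEnergyEquality_of_noTerminalJolt (h : Theses.QuarterJolt.NoTerminalJolt) :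
    ∀ (ν T : ℝ), 0 < ν → 0 < T →
      ∀ (u : ℝ → EuclideanSpace ℝ (Fin 3) → EuclideanSpace ℝ (Fin 3))
        (p : ℝ → EuclideanSpace ℝ (Fin 3) → ℝ),
        Literature.Analysis.FluidPDE.IsClassicalNSSolutionOn (Set.Ico 0 T) ν 0 u p →
        Literature.Analysis.FluidPDE.IsLerayHopfOn T ν 0 (u 0) u →
        Literature.Analysis.FluidPDE.HasRapidSpatialDecay (u 0) →
        VectorCalculus.kineticEnergy (u T) +
          ν * (∫⁻ τ in Set.Ioo 0 T, ∫⁻ x,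
            ENNReal.ofReal (frobeniusNormSq (fderiv ℝ (u τ) x))).toReal =
          VectorCalculus.kineticEnergy (u 0) :=
  fun ν T hν hT u p hcl hLH hdec =>
    energyEquality_of_tendsto_joltFunctional hν hT hcl hLH (h ν T hν hT u p hcl hLH hdec)

end NoTerminalJolt

end Summit.NavierStokesRegularity.NavierStokesRegularity.Theorems

end
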